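import Summits.NavierStokesRegularity.NavierStokesRegularity.Theses.AxisymmetricExtremality
import Summits.NavierStokesRegularity.NavierStokesRegularity.Theorems.AxisymmetricExtremalityMinimalDatumPFoldThresholdFinite
import Summits.NavierStokesRegularity.NavierStokesRegularity.Theorems.AxisymmetricExtremalityMinimalDatumPFoldNotAeZero
import Summits.NavierStokesRegularity.NavierStokesRegularity.Theorems.AxisymmetricExtremalityMinimalDatumPFoldRecentre
import Summits.NavierStokesRegularity.NavierStokesRegularity.Theorems.AxisymmetricExtremalityMinimalDatumPFoldAeToExact
import Summits.NavierStokesRegularity.NavierStokesRegularity.Theorems.AxisymmetricExtremalityMinimalDatumPFoldSymmetryDefectInLimit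
import Summits.NavierStokesRegularity.NavierStokesRegularity.Theorems.AxisymmetricExtremalityMinimalDatumPFoldUniformRegularity
import Summits.NavierStokesRegularity.NavierStokesRegularity.Theorems.AxisymmetricExtremalityMinimalDatumPFoldConcentrationWeakLimitBlowup
import Summits.NavierStokesRegularity.NavierStokesRegularity.Theorems.AxisymmetricExtremalityMinimalDatumPFoldConcentrationNearMinimalLimit
import Summits.NavierStokesRegularity.NavierStokesRegularity.Theorems.AxisymmetricExtremalityMinimalDatumPFoldBranchOfAxisymMinimalDatum
import Summits.NavierStokesRegularity.NavierStokesRegularity.Theorems.AxisymmetricExtremalityPFoldToAxisymmetric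

/-!
# Route AxisymmetricExtremality — crux `MinimalDatumPFold` (stmt-NavierStokesRegularity-15452): the WEAKEST typed form of the
sub-threshold branch — a.e. `p`-fold (not axisymmetric) concentrating sub-threshold data for unboundedly many `p`

Companion of `…MinimalDatumPFoldOfConcentrationBranch.lean` (line `Sketch`, lead c2). The extraction of line `Sketch` uses the
symmetry of the concentrating sub-threshold data only through a.e. equivariance under the ONE rotation `R_{2π/p}` for the
`p` at hand (`stub_symmetryDefectInLimit`). Hence the crux is already implied by — and, through the axisymmetric form, is
EQUIVALENT to — the **p-fold sub-threshold concentration branch**: Clay failure at `ν` ⇒ for every `N` there are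
`p ≥ max(N, 2)` and a sequence of admissible data of critical norm `< ρ_max^pure(ν)` (global), a.e. equivariant under
`R_{2π/p}`, whose Kato solutions on `[0,1)` concentrate at points `(1, x k)`.

* `minimalDatumPFold_of_pFoldConcentrationBranch` (p-fold branch ⇒ crux);
* `pFoldConcentrationBranch_of_minimalDatumPFold` (crux ⇒ axisymmetric branch ⇒ p-fold branch, trivially);
* `minimalDatumPFold_iff_pFoldConcentrationBranch`; registered tools stub `stub_minimalDatumPFoldIffPFoldBranch`.

References: W. Rusin, V. Šverák, arXiv:0911.0500, Cor. 4.2–4.3 [RusinSverak2011]; line card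
`Cruxes/MinimalDatumPFold/Ideas/subthreshold-dissipation-branch.md`.
-/

set_option linter.dupNamespace false

noncomputable section

namespace Summit.NavierStokesRegularity.NavierStokesRegularity.Theorems

/-- **p-fold branch ⇒ crux.** If at every `ν > 0` where Clay (A) fails, for every `N` some `p ≥ max(N,2)` admits a sequence of
a.e. `R_{2π/p}`-equivariant sub-threshold admissible data whose Kato solutions on `[0,1)` concentrate at `(1, x k)`, then
`AxisymmetricExtremality.MinimalDatumPFold` holds: threshold finite (`stub_thresholdFinite_of_clayFailure`), strong `L³` limit in
`M` modulo `Sim` (`stub_concentrationNearMinimalLimit` ∘ `stub_concentrationWeakLimitBlowup` ∘ `stub_uniformRegularity`),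
`stub_symmetryDefectInLimit`, `stub_liftRecentre`, `stub_liftAeToExact`.
[cite: RusinSverak2011, Cor. 4.3 and its proof (arXiv:0911.0500 p. 8)] -/
theorem minimalDatumPFold_of_pFoldConcentrationBranch
    (hB : ∀ ν : ℝ, 0 < ν → (∃ v₀ : EuclideanSpace ℝ (Fin 3) → EuclideanSpace ℝ (Fin 3), ContDiff ℝ (⊤ : ℕ∞) v₀ ∧ Literature.Analysis.FluidPDE.NSWave0.IsDivFree v₀ ∧ Literature.Analysis.FluidPDE.HasRapidSpatialDecay v₀ ∧ ¬ ∃ (u : ℝ → EuclideanSpace ℝ (Fin 3) → EuclideanSpace ℝ (Fin 3)) (p : ℝ → EuclideanSpace ℝ (Fin 3) → ℝ), Literature.Analysis.FluidPDE.IsSmoothOnHalfSpace u ∧ Literature.Analysis.FluidPDE.IsSmoothOnHalfSpace p ∧ Literature.Analysis.FluidPDE.IsNavierStokesSolution ν 0 v₀ u p ∧ Literature.Analysis.FluidPDE.HasBoundedEnergy u) → ∀ N : ℕ, ∃ p : ℕ, N ≤ p ∧ 2 ≤ p ∧ ∃ (U : ℕ → EuclideanSpace ℝ (Fin 3) → EuclideanSpace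 ℝ (Fin 3)) (G : ℕ → Literature.Analysis.FunctionSpaces.HomSobolev (EuclideanSpace ℝ (Fin 3)) (EuclideanSpace ℂ (Fin 3)) (1 / 2 : ℝ)) (u : ℕ → ℝ → EuclideanSpace ℝ (Fin 3) → EuclideanSpace ℝ (Fin 3)) (x : ℕ → EuclideanSpace ℝ (Fin 3)), (∀ k, MeasureTheory.MemLp (U k) 3 (MeasureTheory.volume : MeasureTheory.Measure (EuclideanSpace ℝ (Fin 3))) ∧ (G k).Represents (Literature.Analysis.FunctionSpaces.EuclideanSpace.complexify ∘ U k) ∧ Literature.Analysis.FluidPDE.IsWeaklyDivFree (U k) ∧ ‖G k‖ₑ < Literature.Analysis.FluidPDE.rusinSverakRhoMaxPure ν) ∧ (∀ k, Literature.Analysis.FluidPDE.IsMildNSSolutionOn (Set.Ico 0 1) ν 0 (U k) (u k) ∧ Literature.Analysis.FluidPDE.ContinuousInLpOn (Set.Ico 0 1) 3 (u k) ∧ u k 0 = U k ∧ MeasureTheory.AEStronglyMeasurable (Function.uncurry (u k)) (MeasureTheory.volume.restrict (Set.Ioo (0 : ℝ) 1 ×ˢ (Set.univ : Set (EuclideanSpace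 ℝ (Fin 3)))))) ∧ (∀ r : ℝ, 0 < r → Filter.Tendsto (fun k => MeasureTheory.eLpNorm (Function.uncurry (u k)) ⊤ (MeasureTheory.volume.restrict (Literature.Analysis.FluidPDE.parabolicCylinder r ((1 : ℝ), x k)))) Filter.atTop (nhds ⊤)) ∧ (∀ k, ∀ᵐ y ∂(MeasureTheory.volume : MeasureTheory.Measure (EuclideanSpace ℝ (Fin 3))), U k (WithLp.toLp 2 ![Real.cos (2 * Real.pi / p) * y 0 - Real.sin (2 * Real.pi / p) * y 1, Real.sin (2 * Real.pi / p) * y 0 + Real.cos (2 * Real.pi / p) * y 1, y 2]) = WithLp.toLp 2 ![Real.cos (2 * Real.pi / p) * U k y 0 - Real.sin (2 * Real.pi / p) * U k y 1, Real.sin (2 * Real.pi / p) * U k y 0 + Real.cos (2 * Real.pi / p) * U k y 1, U k y 2])) :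
    Summit.NavierStokesRegularity.NavierStokesRegularity.Theses.AxisymmetricExtremality.MinimalDatumPFold := by
  intro ν hν hclay N
  have hfin : Literature.Analysis.FluidPDE.rusinSverakRhoMaxPure ν < ⊤ :=
    stub_thresholdFinite_of_clayFailure ν hν hclay
  obtain ⟨p, hNp, h2p, U, G, u, x, hadm, hkato, hconc, hsymU⟩ := hB ν hν hclay N
  obtain ⟨lam, x₀, φ, v, g, hlam, _hφ, hmin, htend⟩ :=
    stub_concentrationNearMinimalLimit (stub_concentrationWeakLimitBlowup stub_uniformRegularity)
      ν hν hfin U G u x hadm hkato hconc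
  have hne := stub_minimalDatum_not_aeZero ν v g hmin
  have hL3 : MeasureTheory.MemLp v 3 (MeasureTheory.volume : MeasureTheory.Measure (EuclideanSpace ℝ (Fin 3))) :=
    hmin.1
  obtain ⟨x₁, hx₁, hfix⟩ := stub_symmetryDefectInLimit p (fun j => U (φ j)) lam x₀ v
    (fun j => (hadm (φ j)).1) (fun j => hsymU (φ j)) hlam hL3 hne htend
  obtain ⟨u₁, g₁, hmin₁, hfix₁⟩ := stub_liftRecentre ν p h2p v g hmin x₁ hx₁ hfix
  obtain ⟨u₂, g₂, hmin₂, hsym₂⟩ := stub_liftAeToExact ν p h2p u₁ g₁ hmin₁ hfix₁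
  exact ⟨p, hNp, h2p, u₂, g₂, hmin₂, hsym₂⟩

/-- **Crux ⇒ p-fold branch**: through the axisymmetric branch (`stub_branchOfAxisymMinimalDatum` applied to the axisymmetric
minimal datum supplied by the proved sibling crux `PFoldToAxisymmetric`), taking `p := max N 2`; exact axisymmetry gives a.e.
`R_{2π/p}`-equivariance. [folklore] -/
theorem pFoldConcentrationBranch_of_minimalDatumPFold
    (h : Summit.NavierStokesRegularity.NavierStokesRegularity.Theses.AxisymmetricExtremality.MinimalDatumPFold) :
    ∀ ν : ℝ, 0 < ν → (∃ v₀ : EuclideanSpace ℝ (Fin 3) → EuclideanSpace ℝ (Fin 3), ContDiff ℝ (⊤ : ℕ∞) v₀ ∧ Literature.Analysis.FluidPDE.NSWave0.IsDivFree v₀ ∧ Literature.Analysis.FluidPDE.HasRapidSpatialDecay v₀ ∧ ¬ ∃ (u : ℝ → EuclideanSpace ℝ (Fin 3) → EuclideanSpace ℝ (Fin 3)) (p : ℝ → EuclideanSpace ℝ (Fin 3) → ℝ), Literature.Analysis.FluidPDE.IsSmoothOnHalfSpace u ∧ Literature.Analysis.FluidPDE.IsSmoothOnHalfSpace p ∧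 Literature.Analysis.FluidPDE.IsNavierStokesSolution ν 0 v₀ u p ∧ Literature.Analysis.FluidPDE.HasBoundedEnergy u) → ∀ N : ℕ, ∃ p : ℕ, N ≤ p ∧ 2 ≤ p ∧ ∃ (U : ℕ → EuclideanSpace ℝ (Fin 3) → EuclideanSpace ℝ (Fin 3)) (G : ℕ → Literature.Analysis.FunctionSpaces.HomSobolev (EuclideanSpace ℝ (Fin 3)) (EuclideanSpace ℂ (Fin 3)) (1 / 2 : ℝ)) (u : ℕ → ℝ → EuclideanSpace ℝ (Fin 3) → EuclideanSpace ℝ (Fin 3)) (x : ℕ → EuclideanSpace ℝ (Fin 3)), (∀ k, MeasureTheory.MemLp (U k) 3 (MeasureTheory.volume : MeasureTheory.Measure (EuclideanSpace ℝ (Fin 3))) ∧ (G k).Represents (Literature.Analysis.FunctionSpaces.EuclideanSpace.complexify ∘ U k) ∧ Literature.Analysis.FluidPDE.IsWeaklyDivFree (U k) ∧ ‖G k‖ₑ < Literature.Analysis.FluidPDE.rusinSverakRhoMaxPure ν) ∧ (∀ k, Literature.Analysis.FluidPDE.IsMildNSSolutionOn (Set.Ico 0 1) ν 0 (U k) (u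 k) ∧ Literature.Analysis.FluidPDE.ContinuousInLpOn (Set.Ico 0 1) 3 (u k) ∧ u k 0 = U k ∧ MeasureTheory.AEStronglyMeasurable (Function.uncurry (u k)) (MeasureTheory.volume.restrict (Set.Ioo (0 : ℝ) 1 ×ˢ (Set.univ : Set (EuclideanSpace ℝ (Fin 3)))))) ∧ (∀ r : ℝ, 0 < r → Filter.Tendsto (fun k => MeasureTheory.eLpNorm (Function.uncurry (u k)) ⊤ (MeasureTheory.volume.restrict (Literature.Analysis.FluidPDE.parabolicCylinder r ((1 : ℝ), x k)))) Filter.atTop (nhds ⊤)) ∧ (∀ k, ∀ᵐ y ∂(MeasureTheory.volume : MeasureTheory.Measure (EuclideanSpace ℝ (Fin 3))), U k (WithLp.toLp 2 ![Real.cos (2 * Real.pi / p) * y 0 - Real.sin (2 * Real.pi / p) * y 1, Real.sin (2 * Real.pi / p) * y 0 + Real.cos (2 * Real.pi / p) * y 1, y 2]) = WithLp.toLp 2 ![Real.cos (2 * Real.pi / p) * U k y 0 - Real.sin (2 * Real.pi / p) * U k y 1, Real.sin (2 * Real.pi / p) * U k y 0 + Real.cos (2 * Real.pi / p) * U k y 1,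 U k y 2]) := by
  intro ν hν hclay N
  obtain ⟨U, G, u, x, hadm, hkato, hconc, hax⟩ := stub_branchOfAxisymMinimalDatum ν hν
    (axisymmetricExtremality_pFoldToAxisymmetric_proof ν hν (h ν hν hclay))
  exact ⟨max N 2, le_max_left _ _, le_max_right _ _, U, G, u, x, hadm, hkato, hconc,
    fun k => Filter.Eventually.of_forall fun y => hax k (2 * Real.pi / (max N 2 : ℕ)) y⟩

/-- **The crux is equivalent to the p-fold sub-threshold concentration branch** — the weakest typed form on record of its
open content (a.e. symmetry under one rotation, sub-threshold global data, parabolic concentration). [folklore] -/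
theorem minimalDatumPFold_iff_pFoldConcentrationBranch :
    Summit.NavierStokesRegularity.NavierStokesRegularity.Theses.AxisymmetricExtremality.MinimalDatumPFold ↔ (∀ ν : ℝ, 0 < ν → (∃ v₀ : EuclideanSpace ℝ (Fin 3) → EuclideanSpace ℝ (Fin 3), ContDiff ℝ (⊤ : ℕ∞) v₀ ∧ Literature.Analysis.FluidPDE.NSWave0.IsDivFree v₀ ∧ Literature.Analysis.FluidPDE.HasRapidSpatialDecay v₀ ∧ ¬ ∃ (u : ℝ → EuclideanSpace ℝ (Fin 3) → EuclideanSpace ℝ (Fin 3)) (p : ℝ → EuclideanSpace ℝ (Fin 3) → ℝ), Literature.Analysis.FluidPDE.IsSmoothOnHalfSpace u ∧ Literature.Analysis.FluidPDE.IsSmoothOnHalfSpace p ∧ Literature.Analysis.FluidPDE.IsNavierStokesSolution ν 0 v₀ u p ∧ Literature.Analysis.FluidPDE.HasBoundedEnergy u) → ∀ N : ℕ, ∃ p : ℕ, N ≤ p ∧ 2 ≤ p ∧ ∃ (U : ℕ → EuclideanSpace ℝ (Fin 3) → EuclideanSpace ℝ (Fin 3)) (G : ℕ → Literature.Analysis.FunctionSpaces.HomSobolev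 (EuclideanSpace ℝ (Fin 3)) (EuclideanSpace ℂ (Fin 3)) (1 / 2 : ℝ)) (u : ℕ → ℝ → EuclideanSpace ℝ (Fin 3) → EuclideanSpace ℝ (Fin 3)) (x : ℕ → EuclideanSpace ℝ (Fin 3)), (∀ k, MeasureTheory.MemLp (U k) 3 (MeasureTheory.volume : MeasureTheory.Measure (EuclideanSpace ℝ (Fin 3))) ∧ (G k).Represents (Literature.Analysis.FunctionSpaces.EuclideanSpace.complexify ∘ U k) ∧ Literature.Analysis.FluidPDE.IsWeaklyDivFree (U k) ∧ ‖G k‖ₑ < Literature.Analysis.FluidPDE.rusinSverakRhoMaxPure ν) ∧ (∀ k, Literature.Analysis.FluidPDE.IsMildNSSolutionOn (Set.Ico 0 1) ν 0 (U k) (u k) ∧ Literature.Analysis.FluidPDE.ContinuousInLpOn (Set.Ico 0 1) 3 (u k) ∧ u k 0 = U k ∧ MeasureTheory.AEStronglyMeasurable (Function.uncurry (u k)) (MeasureTheory.volume.restrict (Set.Ioo (0 : ℝ) 1 ×ˢ (Set.univ : Set (EuclideanSpace ℝ (Fin 3)))))) ∧ (∀ r : ℝ, 0 < r → Filter.Tendsto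 (fun k => MeasureTheory.eLpNorm (Function.uncurry (u k)) ⊤ (MeasureTheory.volume.restrict (Literature.Analysis.FluidPDE.parabolicCylinder r ((1 : ℝ), x k)))) Filter.atTop (nhds ⊤)) ∧ (∀ k, ∀ᵐ y ∂(MeasureTheory.volume : MeasureTheory.Measure (EuclideanSpace ℝ (Fin 3))), U k (WithLp.toLp 2 ![Real.cos (2 * Real.pi / p) * y 0 - Real.sin (2 * Real.pi / p) * y 1, Real.sin (2 * Real.pi / p) * y 0 + Real.cos (2 * Real.pi / p) * y 1, y 2]) = WithLp.toLp 2 ![Real.cos (2 * Real.pi / p) * U k y 0 - Real.sin (2 * Real.pi / p) * U k y 1, Real.sin (2 * Real.pi / p) * U k y 0 + Real.cos (2 * Real.pi / p) * U k y 1, U k y 2])) :=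
  ⟨pFoldConcentrationBranch_of_minimalDatumPFold, minimalDatumPFold_of_pFoldConcentrationBranch⟩

/-- **Registered tools stub** (`ledger workitem stub-add … --name stub_minimalDatumPFoldIffPFoldBranch`): the equivalence
crux ⇔ p-fold sub-threshold concentration branch. [folklore] -/
theorem stub_minimalDatumPFoldIffPFoldBranch : Summit.NavierStokesRegularity.NavierStokesRegularity.Theses.AxisymmetricExtremality.MinimalDatumPFold ↔ (∀ ν : ℝ, 0 < ν → (∃ v₀ : EuclideanSpace ℝ (Fin 3) → EuclideanSpace ℝ (Fin 3), ContDiff ℝ (⊤ : ℕ∞) v₀ ∧ Literature.Analysis.FluidPDE.NSWave0.IsDivFree v₀ ∧ Literature.Analysis.FluidPDE.HasRapidSpatialDecay v₀ ∧ ¬ ∃ (u : ℝ → EuclideanSpace ℝ (Fin 3) → EuclideanSpace ℝ (Fin 3)) (p : ℝ → EuclideanSpace ℝ (Fin 3) → ℝ), Literature.Analysis.FluidPDE.IsSmoothOnHalfSpace u ∧ Literature.Analysis.FluidPDE.IsSmoothOnHalfSpace p ∧ Literature.Analysis.FluidPDE.IsNavierStokesSolution ν 0 v₀ u p ∧ Literature.Analysis.FluidPDE.HasBoundedEnergy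 u) → ∀ N : ℕ, ∃ p : ℕ, N ≤ p ∧ 2 ≤ p ∧ ∃ (U : ℕ → EuclideanSpace ℝ (Fin 3) → EuclideanSpace ℝ (Fin 3)) (G : ℕ → Literature.Analysis.FunctionSpaces.HomSobolev (EuclideanSpace ℝ (Fin 3)) (EuclideanSpace ℂ (Fin 3)) (1 / 2 : ℝ)) (u : ℕ → ℝ → EuclideanSpace ℝ (Fin 3) → EuclideanSpace ℝ (Fin 3)) (x : ℕ → EuclideanSpace ℝ (Fin 3)), (∀ k, MeasureTheory.MemLp (U k) 3 (MeasureTheory.volume : MeasureTheory.Measure (EuclideanSpace ℝ (Fin 3))) ∧ (G k).Represents (Literature.Analysis.FunctionSpaces.EuclideanSpace.complexify ∘ U k) ∧ Literature.Analysis.FluidPDE.IsWeaklyDivFree (U k) ∧ ‖G k‖ₑ < Literature.Analysis.FluidPDE.rusinSverakRhoMaxPure ν) ∧ (∀ k, Literature.Analysis.FluidPDE.IsMildNSSolutionOn (Set.Ico 0 1) ν 0 (U k) (u k) ∧ Literature.Analysis.FluidPDE.ContinuousInLpOn (Set.Ico 0 1) 3 (u k) ∧ u k 0 = U k ∧ MeasureTheory.AEStronglyMeasurable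 (Function.uncurry (u k)) (MeasureTheory.volume.restrict (Set.Ioo (0 : ℝ) 1 ×ˢ (Set.univ : Set (EuclideanSpace ℝ (Fin 3)))))) ∧ (∀ r : ℝ, 0 < r → Filter.Tendsto (fun k => MeasureTheory.eLpNorm (Function.uncurry (u k)) ⊤ (MeasureTheory.volume.restrict (Literature.Analysis.FluidPDE.parabolicCylinder r ((1 : ℝ), x k)))) Filter.atTop (nhds ⊤)) ∧ (∀ k, ∀ᵐ y ∂(MeasureTheory.volume : MeasureTheory.Measure (EuclideanSpace ℝ (Fin 3))), U k (WithLp.toLp 2 ![Real.cos (2 * Real.pi / p) * y 0 - Real.sin (2 * Real.pi / p) * y 1, Real.sin (2 * Real.pi / p) * y 0 + Real.cos (2 * Real.pi / p) * y 1, y 2]) = WithLp.toLp 2 ![Real.cos (2 * Real.pi / p) * U k y 0 - Real.sin (2 * Real.pi / p) * U k y 1, Real.sin (2 * Real.pi / p) * U k y 0 + Real.cos (2 * Real.pi / p) * U k y 1, U k y 2])) :=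
  minimalDatumPFold_iff_pFoldConcentrationBranch

end Summit.NavierStokesRegularity.NavierStokesRegularity.Theorems

end
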